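import Summits.HodgeConjecture.CorCM.SexticOcticWeilSixfoldSubproduct
import Summits.HodgeConjecture.CorCM.OcticWeilMultiFourfoldParts
import Summits.HodgeConjecture.CorCM.OcticCurveFourfoldWeilSixfold
import HarnessLib

/-!
# COR-CM — `E × T × B` over a sextic and an octic CM field sharing `k`: the Weil SIXFOLD parts (TWO curve points + the four labels of `B`
# of one sign) of the weights of every product of copies have algebraic lines, GIVEN the Weil plane of `(B × E) × E` — and that plane
# from Markman's hyperbolic-sixfold theorem

Cell `pub-hodgecm2` (COR-CM), seat b30 gen 26 (2026-08-23); count-neutral own lane SEXTIC-OCTIC; sequel of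
`CorCM/SexticOcticWeilSixfoldSubproduct.lean` (`consSlot₃`, `fold₆`, the six-point weights of `B ⊞ E ⊞ E`).  Theorems only; no definition,
no named fact, no `sorry`.  The three-slot twin of gen 25's `CorCM/OcticWeilMultiSixfoldParts.lean` (same proofs: gen 18's RE-SLOTTING
device — the model map is NOT injective on a sixfold part, two curve points, so the second curve copy is moved to the fresh slot of
`Y⁺ = E ⊞ Y` before projecting).

* §1 `weightClassesAlg_le_algebraicClasses_of_isSixPartS_cons` — a sixfold part of a weight of `⨁_j A(consSlot₃ (κ' j))` on which the
  projection to `Y⁺` is injective with slots in the range of `fold₆`: pull its image back to the sub-product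
  (`CMWeights.weightClassesAlg_map_le_algebraicClasses`) and lift along `κ'` (distribution lemma);
* §2 `…_of_factor` and **`weightClassesAlg_le_algebraicClasses_of_isSixPartS`** — ANY slot map `κ : Fin N → Fin 3`: re-slot the second
  curve copy of the part to the fresh slot `0` of `Y⁺` (`κ = consSlot₃ ∘ κ'`), which separates the two curve points;
* §3 **`weilClassesOf_sixfold_le_algebraicClasses_of_frameS_of_markmanSixfold`** — the Weil plane of `((B × E) × E, (ι(i₂δ) × ι(δ)) × ι(δ))`
  from `Markman2025_weilClasses_algebraic_hyperbolicSixfold` (gen 18's aiming theorem fed with the type count of the `(1,3)`-reading,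
  gen 25's `OcticWeilMulti.typeCount_sixfold_of_frameO` BY NAME).
HONEST FRAMING: nothing about the Hodge conjecture is concluded here; `HC_CM` is not asserted.
[cite: Markman2025SecantWeil, Thm 1.5.1] [cite: Deligne1982HodgeCycles, §5 (c)] [cite: Milne2020HodgeClassesAV, 1.2 (a) and Thm. 1]
[cite: MoonenZarhin1995Duke, Thm. 2.4]

## References
* [Markman2025SecantWeil] E. Markman, arXiv:2502.03415, Thm. 1.5.1.  [Deligne1982HodgeCycles] P. Deligne, LNM 900 (1982), §5 (c).
  [Milne2020HodgeClassesAV] J. S. Milne, arXiv:2010.08857, 1.2 (a), Thm. 1.  [MoonenZarhin1995Duke] B. Moonen, Yu. Zarhin, Duke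
  Math. J. 77 (1995), Thm. 2.4.
-/

noncomputable section

open CategoryTheory CategoryTheory.Limits NumberField

namespace Summit.HodgeConjecture.CorCM.SexticOcticWeil

open Literature.AlgebraicGeometry Literature.AlgebraicGeometry.Motives Literature.AlgebraicGeometry.HodgeTheory
open Literature.AlgebraicGeometry.ComplexMultiplication (IsCMTypeRealisation)
open Literature.AlgebraicGeometry.Pohlmann1968
open Literature.AlgebraicTopology.SingularHomology
open Literature.NumberTheory.ComplexMultiplication
open Summit.HodgeConjecture.CorCM.Census.SexticOcticWeil (PtS IsSixPartS)
open Summit.HodgeConjecture.CorCM.CMWeights (weightClassesAlg_comp_le_algebraicClasses_of_injOn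
  weightClassesAlg_map_le_algebraicClasses sigma_map_injective)
open Summit.HodgeConjecture.CorCM.OcticCurveFourfold (weilClassesOf_le_algebraicClasses_cmFourfold_prod_cmCurve_prod_cmCurve_of_markmanSixfold)
open Summit.HodgeConjecture.CorCM.OcticWeilMulti (typeCount_sixfold_of_frameO)
open Summit.HodgeConjecture.CorCM.PairWeights

open scoped Classical

section Sixfold

variable {I : Type} {Kf : I → Type} [∀ i, Field (Kf i)] [∀ i, NumberField (Kf i)]
  {i₀ i₁ i₂ : I} {e₁ : (Kf i₁ →+* ℂ) ≃ Fin 3 × Bool} {e₂ : (Kf i₂ →+* ℂ) ≃ Fin 4 × Bool} {τ : Kf i₀ →+* ℂ}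
  {i₁' : Kf i₀ →+* Kf i₁} {i₂' : Kf i₀ →+* Kf i₂}
  (hk : ∀ σ : Kf i₀ →+* ℂ, σ = τ ∨ σ = ComplexEmbedding.conjugate τ)
  (he₁_sign : ∀ s : Kf i₁ →+* ℂ, (e₁ s).2 = true ↔ s.comp i₁' = τ)
  (he₂_sign : ∀ t : Kf i₂ →+* ℂ, (e₂ t).2 = true ↔ t.comp i₂' = τ)
  {A : Fin 3 → AbelianVariety ℂ} {Φ : ∀ j : Fin 3, CMType (Kf (soSlots i₀ i₁ i₂ j))}
  {ι : ∀ j, 𝓞 (Kf (soSlots i₀ i₁ i₂ j)) →+* End (A j)}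
  {θ : ∀ j, Kf (soSlots i₀ i₁ i₂ j) →+* Module.End ℂ (complexBetti (A j).X 1)}
  (hA : ∀ j, IsCMTypeRealisation (Φ j) (A j) (ι j) (θ j))
  {δ : 𝓞 (Kf i₀)} {d : ℕ} (hτ : τ (δ : Kf i₀) = Complex.I * (Real.sqrt d : ℂ))

/-! ## §1 Sixfold parts of `⨁_j A(consSlot₃ (κ' j))` with injective projection to `Y⁺` -/

include hk he₁_sign he₂_sign hA hτ in
/-- **Re-slotted form.**  For `κ' : Fin N → Fin 4`, a sixfold part `G` of a weight of `X = ⨁_j A(consSlot₃ (κ' j))` on which the projection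
`P' (j, s) = (κ' j, s)` to `Y⁺` is injective and takes slots in `{3, 1, 0}` has an algebraic line: `P'(G)` is the image under `fold₆` of a
six-point weight of `B ⊞ E ⊞ E` of constant sign, pulled back to `Y⁺` (`CMWeights.weightClassesAlg_map_le_algebraicClasses`) and lifted
along `κ'` (distribution lemma). [cite: Milne2020HodgeClassesAV, 1.2 (a) and Thm. 1] -/
theorem weightClassesAlg_le_algebraicClasses_of_isSixPartS_cons
    (hW₃ : weilClassesOf (((A 2).prod (A 0)).prod (A 0))
      (AbelianVariety.prodLift
        (AbelianVariety.fst ((A 2).prod (A 0)) (A 0) ≫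
          AbelianVariety.prodLift (AbelianVariety.fst (A 2) (A 0) ≫ ι 2 (RingOfIntegers.mapRingHom i₂' δ))
            (AbelianVariety.snd (A 2) (A 0) ≫ ι 0 δ))
        (AbelianVariety.snd ((A 2).prod (A 0)) (A 0) ≫ ι 0 δ)) 3 d ≤
      algebraicClasses (((A 2).prod (A 0)).prod (A 0)).X 3)
    {N : ℕ} (κ' : Fin N → Fin 4) {b : Bool} {G : Finset ((j : Fin N) × (Kf (soSlots i₀ i₁ i₂ (consSlot₃ (κ' j))) →+* ℂ))}
    (hG : IsSixPartS (fun x => toPtS e₁ e₂ τ ⟨consSlot₃ (κ' x.1), x.2⟩) b G)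
    (hinj : Set.InjOn (Sigma.map κ' (fun _ => id) :
      ((j : Fin N) × (Kf (soSlots i₀ i₁ i₂ (consSlot₃ (κ' j))) →+* ℂ)) →
        ((l : Fin 4) × (Kf (soSlots i₀ i₁ i₂ (consSlot₃ l)) →+* ℂ))) ↑G)
    (hrange : ∀ x ∈ G, κ' x.1 ∈ Set.range fold₆) :
    weightClassesAlg (fun j => A (consSlot₃ (κ' j))) (fun j => ι (consSlot₃ (κ' j))) (2 * 3) G ≤
      algebraicClasses (⨁ fun j => A (consSlot₃ (κ' j))).X 3 := by
  set P' : ((j : Fin N) × (Kf (soSlots i₀ i₁ i₂ (consSlot₃ (κ' j))) →+* ℂ)) →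
      ((l : Fin 4) × (Kf (soSlots i₀ i₁ i₂ (consSlot₃ l)) →+* ℂ)) := Sigma.map κ' (fun _ => id) with hP'
  set T' := G.image P' with hT'
  have hT'card : T'.card = 2 * 3 := by rw [hT', Finset.card_image_of_injOn hinj, hG.1]
  -- the sub-product weight
  set F₃ : ((l : Fin 3) × (Kf (soSlots i₀ i₁ i₂ (consSlot₃ (fold₆ l))) →+* ℂ)) →
      ((l : Fin 4) × (Kf (soSlots i₀ i₁ i₂ (consSlot₃ l)) →+* ℂ)) := fun z => ⟨fold₆ z.1, z.2⟩ with hF₃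
  have hF₃inj : Function.Injective F₃ :=
    sigma_map_injective (K := fun l => Kf (soSlots i₀ i₁ i₂ (consSlot₃ l))) fold₆ fold₆_injective
  set T₃ := T'.preimage F₃ hF₃inj.injOn with hT₃
  have hT₃map : T₃.map ⟨F₃, hF₃inj⟩ = T' := by
    rw [Finset.map_eq_image, hT₃]
    change (T'.preimage F₃ hF₃inj.injOn).image F₃ = T'
    rw [Finset.image_preimage]
    have key : ∀ y : (l : Fin 4) × (Kf (soSlots i₀ i₁ i₂ (consSlot₃ l)) →+* ℂ), y.1 ∈ Set.range fold₆ → y ∈ Set.range F₃ := by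
      rintro ⟨l, t⟩ ⟨l₃, rfl⟩
      exact ⟨⟨l₃, t⟩, rfl⟩
    refine Finset.filter_true_of_mem fun y hy => ?_
    obtain ⟨x, hx, rfl⟩ := Finset.mem_image.1 hy
    exact key (P' x) (hrange x hx)
  have hT₃card : T₃.card = 2 * 3 := by rw [← hT'card, ← hT₃map, Finset.card_map]
  have hsgn : ∀ z ∈ T₃, toPtS e₁ e₂ τ ⟨consSlot₃ (fold₆ z.1), z.2⟩ = Sum.inl b ∨
      ∃ a : Fin 4, toPtS e₁ e₂ τ ⟨consSlot₃ (fold₆ z.1), z.2⟩ = Sum.inr (Sum.inr (a, b)) := by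
    intro z hz
    have hz' : F₃ z ∈ T' := Finset.mem_preimage.1 hz
    obtain ⟨x, hx, hxz⟩ := Finset.mem_image.1 hz'
    have hv : toPtS e₁ e₂ τ ⟨consSlot₃ (κ' x.1), x.2⟩ = toPtS e₁ e₂ τ ⟨consSlot₃ (fold₆ z.1), z.2⟩ :=
      congrArg (fun w : (l : Fin 4) × (Kf (soSlots i₀ i₁ i₂ (consSlot₃ l)) →+* ℂ) =>
        toPtS e₁ e₂ τ (⟨consSlot₃ w.1, w.2⟩ : (l : Fin 3) × (Kf (soSlots i₀ i₁ i₂ l) →+* ℂ))) hxz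
    rw [← hv]
    exact hG.mem_cases hx
  have halg₃ := weightClassesAlg_three_le_algebraicClasses_of_signS₆ hk he₁_sign he₂_sign hτ hW₃ b T₃ hT₃card hsgn
  -- pull back to `Y⁺` and lift along `κ'`
  have hA' : ∀ l : Fin 4, IsCMTypeRealisation (Φ (consSlot₃ l)) (A (consSlot₃ l)) (ι (consSlot₃ l)) (θ (consSlot₃ l)) :=
    fun l => hA (consSlot₃ l)
  have hY' := weightClassesAlg_map_le_algebraicClasses (K := fun l => Kf (soSlots i₀ i₁ i₂ (consSlot₃ l)))
    (A := fun l => A (consSlot₃ l)) (Φ := fun l => Φ (consSlot₃ l)) (ι := fun l => ι (consSlot₃ l)) (θ := fun l => θ (consSlot₃ l))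
    hA' fold₆ fold₆_injective hT₃card halg₃
  rw [hT₃map] at hY'
  exact weightClassesAlg_comp_le_algebraicClasses_of_injOn (K := fun l => Kf (soSlots i₀ i₁ i₂ (consSlot₃ l)))
    (A := fun l => A (consSlot₃ l)) (Φ := fun l => Φ (consSlot₃ l)) (ι := fun l => ι (consSlot₃ l)) (θ := fun l => θ (consSlot₃ l))
    hA' κ' hG.1 hinj hY'

/-! ## §2 Any slot map: re-slot the second curve copy -/

include hk he₁_sign he₂_sign hA hτ in
/-- **Re-slotting.**  For `κ : Fin N → Fin 3` FACTORED as `κ = consSlot₃ ∘ κ'` (so that `X = ⨁_j A(κ j)` is LITERALLY `⨁_j A(consSlot₃ (κ' j))`),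
a sixfold part `G` of a weight of `X` whose two curve points are SEPARATED by `κ'` and whose slots under `κ'` lie in `{3, 1, 0}` has an
algebraic line (§1; injectivity of the projection from `IsSixPartS.eq_of_inr`). [cite: Milne2020HodgeClassesAV, 1.2 (a) and Thm. 1] -/
theorem weightClassesAlg_le_algebraicClasses_of_isSixPartS_of_factor
    (hW₃ : weilClassesOf (((A 2).prod (A 0)).prod (A 0))
      (AbelianVariety.prodLift
        (AbelianVariety.fst ((A 2).prod (A 0)) (A 0) ≫
          AbelianVariety.prodLift (AbelianVariety.fst (A 2) (A 0) ≫ ι 2 (RingOfIntegers.mapRingHom i₂' δ))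
            (AbelianVariety.snd (A 2) (A 0) ≫ ι 0 δ))
        (AbelianVariety.snd ((A 2).prod (A 0)) (A 0) ≫ ι 0 δ)) 3 d ≤
      algebraicClasses (((A 2).prod (A 0)).prod (A 0)).X 3)
    {N : ℕ} (κ : Fin N → Fin 3) (κ' : Fin N → Fin 4) (hκ : ∀ j, consSlot₃ (κ' j) = κ j)
    {b : Bool} {G : Finset ((j : Fin N) × (Kf (soSlots i₀ i₁ i₂ (κ j)) →+* ℂ))}
    (hG : IsSixPartS (fun x => toPtS e₁ e₂ τ ((Sigma.map κ (fun _ => id) :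
      ((j : Fin N) × (Kf (soSlots i₀ i₁ i₂ (κ j)) →+* ℂ)) → ((l : Fin 3) × (Kf (soSlots i₀ i₁ i₂ l) →+* ℂ))) x)) b G)
    (hsep : ∀ x ∈ G, ∀ x' ∈ G, toPtS e₁ e₂ τ ⟨κ x.1, x.2⟩ = Sum.inl b → toPtS e₁ e₂ τ ⟨κ x'.1, x'.2⟩ = Sum.inl b → x ≠ x' →
      κ' x.1 ≠ κ' x'.1)
    (hrange : ∀ x ∈ G, κ' x.1 ∈ Set.range fold₆) :
    weightClassesAlg (fun j => A (κ j)) (fun j => ι (κ j)) (2 * 3) G ≤ algebraicClasses (⨁ fun j => A (κ j)).X 3 := by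
  -- `X` is literally the re-slotted product
  obtain rfl : κ = fun j => consSlot₃ (κ' j) := funext fun j => (hκ j).symm
  refine weightClassesAlg_le_algebraicClasses_of_isSixPartS_cons hk he₁_sign he₂_sign hA hτ hW₃ κ' hG ?_ hrange
  -- injectivity of the projection on `G`
  intro x hx x' hx' hxx'
  have hfst : κ' x.1 = κ' x'.1 := congrArg Sigma.fst hxx'
  have hvv : toPtS e₁ e₂ τ ⟨consSlot₃ (κ' x.1), x.2⟩ = toPtS e₁ e₂ τ ⟨consSlot₃ (κ' x'.1), x'.2⟩ := by
    have h := congrArg (fun z : (l : Fin 4) × (Kf (soSlots i₀ i₁ i₂ (consSlot₃ l)) →+* ℂ) =>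
      toPtS e₁ e₂ τ (⟨consSlot₃ z.1, z.2⟩ : (l : Fin 3) × (Kf (soSlots i₀ i₁ i₂ l) →+* ℂ))) hxx'
    exact h
  by_contra hne
  rcases hy : toPtS e₁ e₂ τ ⟨consSlot₃ (κ' x.1), x.2⟩ with c | q
  · have hc : c = b := by
      rcases hG.mem_cases hx with h | ⟨a, h⟩
      · change toPtS e₁ e₂ τ ⟨consSlot₃ (κ' x.1), x.2⟩ = _ at h; rw [hy] at h; exact Sum.inl.inj h
      · change toPtS e₁ e₂ τ ⟨consSlot₃ (κ' x.1), x.2⟩ = _ at h; rw [hy] at h; exact absurd h Sum.inl_ne_inr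
    subst hc
    rw [hy] at hvv
    exact hsep x hx x' hx' hy hvv.symm hne hfst
  · rw [hy] at hvv
    rcases q with q₁ | q₂
    · rcases hG.mem_cases hx with h | ⟨a, h⟩
      · change toPtS e₁ e₂ τ ⟨consSlot₃ (κ' x.1), x.2⟩ = _ at h; rw [hy] at h; exact absurd h Sum.inr_ne_inl
      · change toPtS e₁ e₂ τ ⟨consSlot₃ (κ' x.1), x.2⟩ = _ at h; rw [hy, Sum.inr.injEq] at h; exact absurd h Sum.inl_ne_inr
    · exact hne (hG.eq_of_inr hx hx' hy hvv.symm)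

include hk he₁_sign he₂_sign hA hτ in
/-- **THE SIXFOLD PARTS HAVE ALGEBRAIC LINES (any slot map).**  For `κ : Fin N → Fin 3` and a sixfold part `G` (sign `b`) of a weight of
`X = ⨁_j A(κ j)` — two curve points `x₁ ≠ x₂` over `inl b` (two different copies of `E`) and the four labels `(2, a, b)` — `H⁶(X)_G ⊆ N³ H⁶(X)`,
GIVEN the Weil plane of `(B × E) × E`.  Re-slot: `κ' j₂ = 0`, `κ' j = (κ j) + 1` otherwise (`consSlot₃ ∘ κ' = κ`; `κ' j₁ = 1 ≠ 0` separates the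
curve points; the `B`-points keep slot `3`), then the factored form. [cite: Milne2020HodgeClassesAV, 1.2 (a) and Thm. 1]
[cite: Deligne1982HodgeCycles, §5 (c)] -/
theorem weightClassesAlg_le_algebraicClasses_of_isSixPartS
    (hW₃ : weilClassesOf (((A 2).prod (A 0)).prod (A 0))
      (AbelianVariety.prodLift
        (AbelianVariety.fst ((A 2).prod (A 0)) (A 0) ≫
          AbelianVariety.prodLift (AbelianVariety.fst (A 2) (A 0) ≫ ι 2 (RingOfIntegers.mapRingHom i₂' δ))
            (AbelianVariety.snd (A 2) (A 0) ≫ ι 0 δ))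
        (AbelianVariety.snd ((A 2).prod (A 0)) (A 0) ≫ ι 0 δ)) 3 d ≤
      algebraicClasses (((A 2).prod (A 0)).prod (A 0)).X 3)
    {N : ℕ} (κ : Fin N → Fin 3) {b : Bool} {G : Finset ((j : Fin N) × (Kf (soSlots i₀ i₁ i₂ (κ j)) →+* ℂ))}
    (hG : IsSixPartS (fun x => toPtS e₁ e₂ τ ((Sigma.map κ (fun _ => id) :
      ((j : Fin N) × (Kf (soSlots i₀ i₁ i₂ (κ j)) →+* ℂ)) → ((l : Fin 3) × (Kf (soSlots i₀ i₁ i₂ l) →+* ℂ))) x)) b G) :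
    G.card = 2 * 3 ∧ weightClassesAlg (fun j => A (κ j)) (fun j => ι (κ j)) (2 * 3) G ≤
      algebraicClasses (⨁ fun j => A (κ j)).X 3 := by
  refine ⟨hG.1, ?_⟩
  -- the two curve points, in two different copies
  obtain ⟨x₁, hx₁, x₂, hx₂, hne, hv₁, hv₂⟩ := hG.exists_pair
  obtain ⟨σ₁, hσ₁, hσ₁'⟩ := fst_eq_zero_of_toPtS_eq_inl (e₁ := e₁) (e₂ := e₂) hk (x := ⟨κ x₁.1, x₁.2⟩) hv₁
  obtain ⟨σ₂, hσ₂, hσ₂'⟩ := fst_eq_zero_of_toPtS_eq_inl (e₁ := e₁) (e₂ := e₂) hk (x := ⟨κ x₂.1, x₂.2⟩) hv₂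
  have hκ₁ : κ x₁.1 = 0 := congrArg Sigma.fst hσ₁
  have hκ₂ : κ x₂.1 = 0 := congrArg Sigma.fst hσ₂
  have hj : x₁.1 ≠ x₂.1 := by
    intro hj
    apply hne
    have h1 : (⟨κ x₁.1, x₁.2⟩ : (l : Fin 3) × (Kf (soSlots i₀ i₁ i₂ l) →+* ℂ)) = ⟨κ x₂.1, x₂.2⟩ := by
      rw [hσ₁, hσ₂, hσ₁', hσ₂']
    obtain ⟨j₁, s₁⟩ := x₁
    obtain ⟨j₂, s₂⟩ := x₂
    change j₁ = j₂ at hj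
    subst hj
    simp only [Sigma.mk.injEq, heq_eq_eq, true_and] at h1 ⊢
    exact h1
  -- the curve points of `G` are exactly `x₁`, `x₂`
  have hmem : ∀ y ∈ G, toPtS e₁ e₂ τ ⟨κ y.1, y.2⟩ = Sum.inl b → y = x₁ ∨ y = x₂ := by
    intro y hy' hyv
    obtain ⟨z₁, z₂, -, h12⟩ := Finset.card_eq_two.1 hG.2.1
    have hall : ∀ y ∈ G, toPtS e₁ e₂ τ ⟨κ y.1, y.2⟩ = Sum.inl b → y = z₁ ∨ y = z₂ := by
      intro y hy'' hyv'
      have : y ∈ G.filter fun x => toPtS e₁ e₂ τ ((Sigma.map κ (fun _ => id) :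
          ((j : Fin N) × (Kf (soSlots i₀ i₁ i₂ (κ j)) →+* ℂ)) → ((l : Fin 3) × (Kf (soSlots i₀ i₁ i₂ l) →+* ℂ))) x) =
            Sum.inl b := Finset.mem_filter.2 ⟨hy'', hyv'⟩
      rw [h12, Finset.mem_insert, Finset.mem_singleton] at this
      exact this
    rcases hall x₁ hx₁ hv₁ with h₁ | h₁ <;> rcases hall x₂ hx₂ hv₂ with h₂ | h₂
    · exact absurd (h₁.trans h₂.symm) hne
    · rcases hall y hy' hyv with h | h
      · exact Or.inl (h.trans h₁.symm)
      · exact Or.inr (h.trans h₂.symm)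
    · rcases hall y hy' hyv with h | h
      · exact Or.inr (h.trans h₂.symm)
      · exact Or.inl (h.trans h₁.symm)
    · exact absurd (h₁.trans h₂.symm) hne
  -- the re-slotting `κ'`
  let κ' : Fin N → Fin 4 := fun j => if j = x₂.1 then 0 else (κ j).succ
  have hκ' : ∀ j, consSlot₃ (κ' j) = κ j := by
    intro j
    by_cases h : j = x₂.1
    · simp only [κ', if_pos h]; rw [h, hκ₂]; rfl
    · simp only [κ', if_neg h]; rfl
  have hκ'₂ : κ' x₂.1 = 0 := by simp only [κ', if_pos rfl]
  have hκ'₁ : κ' x₁.1 = (0 : Fin 3).succ := by simp only [κ', if_neg hj]; rw [hκ₁]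
  refine weightClassesAlg_le_algebraicClasses_of_isSixPartS_of_factor hk he₁_sign he₂_sign hA hτ hW₃ κ κ' hκ' hG ?_ ?_
  · -- separation of the curve points
    intro x hx x' hx' hxv hx'v hxx' hfst
    rcases hmem x hx hxv with rfl | rfl <;> rcases hmem x' hx' hx'v with rfl | rfl
    · exact hxx' rfl
    · rw [hκ'₁, hκ'₂] at hfst; exact absurd hfst (Fin.succ_ne_zero _)
    · rw [hκ'₁, hκ'₂] at hfst; exact absurd hfst.symm (Fin.succ_ne_zero _)
    · exact hxx' rfl
  · -- slots in `{3, 1, 0}`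
    intro x hx
    refine mem_range_fold₆ ?_
    rcases hG.mem_cases hx with h | ⟨a, h⟩
    · rcases hmem x hx h with rfl | rfl
      · exact Or.inr (Or.inl hκ'₁)
      · exact Or.inr (Or.inr hκ'₂)
    · -- a `B` point: slot `2`, in a copy different from `x₂`
      change toPtS e₁ e₂ τ ⟨κ x.1, x.2⟩ = _ at h
      have hxm : κ x.1 = 2 := fst_eq_two_of_toPtS_eq_inr_inr (x := ⟨κ x.1, x.2⟩) h
      have hne₂ : x.1 ≠ x₂.1 := by
        intro hh
        rw [hh, hκ₂] at hxm
        exact absurd hxm (by decide)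
      left
      show κ' x.1 = (2 : Fin 3).succ
      simp only [κ', if_neg hne₂, hxm]

end Sixfold

/-! ## §3 The Weil plane of `(B × E) × E` from Markman's hyperbolic-sixfold theorem -/

section Markman

variable {I : Type} {Kf : I → Type} [∀ i, Field (Kf i)] [∀ i, NumberField (Kf i)] [∀ i, IsCMField (Kf i)]
  {i₀ i₁ i₂ : I} {e₂ : (Kf i₂ →+* ℂ) ≃ Fin 4 × Bool} {τ : Kf i₀ →+* ℂ}
  {A : Fin 3 → AbelianVariety ℂ} {Φ : ∀ j : Fin 3, CMType (Kf (soSlots i₀ i₁ i₂ j))}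
  {ι : ∀ j, 𝓞 (Kf (soSlots i₀ i₁ i₂ j)) →+* End (A j)}
  {θ : ∀ j, Kf (soSlots i₀ i₁ i₂ j) →+* Module.End ℂ (complexBetti (A j).X 1)}

/-- **The Weil plane of the sixfold `((B × E) × E, (ι(i₂δ) × ι(δ)) × ι(δ))` is algebraic, GIVEN Markman's hyperbolic-sixfold theorem** —
gen 18's aiming theorem `OcticCurveFourfold.weilClassesOf_le_algebraicClasses_cmFourfold_prod_cmCurve_prod_cmCurve_of_markmanSixfold` (Weil
type `(3,3)`) fed with the type count of the `(1,3)`-reading (gen 25's `OcticWeilMulti.typeCount_sixfold_of_frameO`, one slot, position `0`).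
[cite: Markman2025SecantWeil, Thm 1.5.1] [cite: Deligne1982HodgeCycles, §5 (c)] -/
theorem weilClassesOf_sixfold_le_algebraicClasses_of_frameS_of_markmanSixfold (hM6 : Markman2025_weilClasses_algebraic_hyperbolicSixfold)
    (h8 : Module.finrank ℚ (Kf i₂) = 8) (h2 : Module.finrank ℚ (Kf i₀) = 2) (i₂' : Kf i₀ →+* Kf i₂)
    {δ : 𝓞 (Kf i₀)} {d : ℕ} (hd : 0 < d) (hδ : ((δ : Kf i₀)) ^ 2 = -(d : Kf i₀))
    (hA : ∀ j, IsCMTypeRealisation (Φ j) (A j) (ι j) (θ j))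
    (he₂_sign : ∀ t : Kf i₂ →+* ℂ, (e₂ t).2 = true ↔ t.comp i₂' = τ)
    (hΦ₂ : ∀ t : Kf i₂ →+* ℂ, t ∈ (Φ 2).1 ↔ (e₂ t).2 = decide ((e₂ t).1 = 0))
    (hΨ : ∀ σ : Kf i₀ →+* ℂ, σ ∈ (Φ 0).1 ↔ σ = τ) :
    weilClassesOf (((A 2).prod (A 0)).prod (A 0))
      (AbelianVariety.prodLift
        (AbelianVariety.fst ((A 2).prod (A 0)) (A 0) ≫
          AbelianVariety.prodLift (AbelianVariety.fst (A 2) (A 0) ≫ ι 2 (RingOfIntegers.mapRingHom i₂' δ))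
            (AbelianVariety.snd (A 2) (A 0) ≫ ι 0 δ))
        (AbelianVariety.snd ((A 2).prod (A 0)) (A 0) ≫ ι 0 δ)) 3 d ≤
      algebraicClasses (((A 2).prod (A 0)).prod (A 0)).X 3 := by
  have hP : ((Finset.univ : Finset (Fin 4)).filter fun a => (fun (_ : Fin 1) (a : Fin 4) => decide (a = 0)) 0 a = true).card = 1 := by
    decide
  exact weilClassesOf_le_algebraicClasses_cmFourfold_prod_cmCurve_prod_cmCurve_of_markmanSixfold hM6 h8 h2 i₂' (hA 2) (hA 0) hd hδ
    fun τ' => typeCount_sixfold_of_frameO (P := fun (_ : Fin 1) (a : Fin 4) => decide (a = 0)) (m := 0) h2 he₂_sign hP hΦ₂ hΨ τ'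

end Markman

end Summit.HodgeConjecture.CorCM.SexticOcticWeil

end
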